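import Summits.QuantumFields.BalabanUV.Beta.GAN24.Lin4ZeroMode
import Summits.QuantumFields.BalabanUV.Beta.GAN24.ChargeTowerLegs
import Summits.QuantumFields.BalabanUV.Beta.GAN24.FaceWeightedSandwich
import Summits.QuantumFields.BalabanUV.Beta.GAN24.TableDressingZeroMode
import Summits.QuantumFields.BalabanUV.Beta.GAN24.Push4Iter
import Summits.QuantumFields.BalabanUV.Beta.KernelWardSwap

/-!
# `BalabanUV.Beta.GAN24.FaceReadTransportCharges` (PART 1 of the transport rows; PART 2 = `FaceReadTransportStep`) — binder row G-an2-4 ∕ (CONV-C), W-slot (α-0), ROW (C) AT LEVELS `≥ 1`, the OWNER's two-index pair-form tower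
# (`PairFormPeriodTower.pairFormLS_tower₂`, RULING R-gan24p1-g40-1), **THE TRANSPORT ROWS AT EVERY FACE PERIOD**: the period-`P` four exit-face read of the
# linear part `𝒜^E_j X = lin4 c G̃_j Lc X` of road-P2's E-frame comb step is a scalar multiple of the period-`Lc·P` four exit-face read of `X` ONE LEVEL DOWN —
#   `FF_P(lin4 c G̃_j Lc X)(μ,ν;α,β) = (c·K_j⁴∕2)·( FF_{Lc·P}(X)(μ,ν;α,β) + FF_{Lc·P}(Xᵀ)(μ,ν;α,β) )`,  `K_j = s_f·s_m·cH_j`, `cH_j = (stepScale_j·Lc^{d+1})⁻¹`, `Xᵀ κ u κ′ u′ = X κ′ u′ κ u`,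
# for EVERY `P ≥ 1`, every level `j`, in-block root, every jointly `Lc`-covariant `LocStencil₂` table `X`, all units symbolic — so the tower's period index `m ↦ m+1` is
# `P = Lc^m ↦ Lc^{m+1}` (road-P2 chair `b2b-balaban-gan24-p2`, gen 50; journal [GAN24P2-G50-INTENT2])

NOT IN PRINT; OUR BOOKKEEPING ([folklore] `tsum` bookkeeping BY NAME: the generic weighted engine `FaceWeightedLinT2.inner_weighted_linT2` (this gen) at `K = G̃_j` with road-P2 g41's
WEIGHTED coarse-leg charges of the co-dressed step resolvent `ChargeTowerLegs.hasSum_row_coord_inl ∕ _inr ∕ hasSum_col_coord_inl ∕ _inr` and `CoarseGaugeSourceResponse.tsum_coord_colH`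
(face weight of period `P` on the coarse index ⟹ exit face of period `Lc·P` on the fine index, leaf-04 g62's `FaceWeightedSandwich.emod_mul_eq_iff`), the cell bond moved onto the lower
table by the joint-periodicity swap (leaf-06 K4a's argument), the swapped bi-vertex by an2's `KernelWardSwap.vertex2OfK_swap_eq_transpose` and leaf-04's `Lin4Additive.vertex2OfK_add`;
0 `def`, 0 cited fact, 0 `def … : Prop`, 0 sorry).  HONEST FRAMING (cell contract, verbatim): «discharging `BetaPertH` makes Bałaban's UV stability UNCONDITIONAL — a real
constructive-QFT result; it is NOT the continuum limit and NOT the Clay problem.»  HONEST DEPENDENCY (verbatim): «continuum YM on T⁴ ⇐ BetaPertH ∧ nine spine estimates (0/9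
proved); BetaPertH ⇐ (D1) ∧ (D4) ∧ CAP+tail; G-an2-4 gates asym, D1 and NE2/3/4.»

WHY.  `CombChargeTowerStepZero` (this gen) gave the period-index-`0` row of the OWNER's tower from road-P2 g36's one-step law; its lower term is the period-`Lc` face read
`Lc⁴·FF_Lc(T̃_j)`.  The rows at period index `m ≥ 1` need the face read at period `P = Lc^m` of the NEXT member `T̃_{j+1} = 𝒜^E_j T̃_j + b̃_j` (`T2RecOfUnitSplit`): the forcing's
face read `FF_P(b̃_j)` is the suppliers' (leaf-06's K6c `FourFaceSourceWords` opens it into leaf-04's three words with legs one class deeper), and the TRANSPORT term is this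
file: reading `lin4 c G̃_j Lc X` against face indicators of period `P` on its two coarse bonds and two coarse legs, each of the four readers meets a weighted coarse-leg charge of
`G̃_j` (rows ∕ columns ∕ `ℋ`-columns), which is `∓K_j` times the indicator of the exit face of period `Lc·P` one level down (`[t % Lc = Lc−1] ∧ [⌊t∕Lc⌋ % P = P−1] ↔
[t % (Lc·P) = Lc·P−1]`) — so the read lands on `FF_{Lc·P}` of the table, both slot orders (the bi-vertex is symmetrised), i.e. on `X` and on `Xᵀ`.  With the OWNER's
`FaceReadTranspose.faceRead_transpose_of_cov` (✓ p378368) the `Xᵀ` read is the bond-swapped read of `X`; the member corollary and the `LS` rows `hstep (m ≥ 1, j)` are the sequel.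
WHAT (generic `d`, cell `Lc ≥ 1`, in-block root `r ∈ box (d+1) Lc`, every `j`, units `s_f s_m` symbolic, `G̃_j := unitK s_f s_m (coDressKBmAt (toSite r) Lc (KInvStep Lc j))`):
* §1 **`lin4_eq_half_linT2_symm`** — `lin4 c K N X μ y ν y′ = (−c∕2) • linT2 K N (X + Xᵀ) μ y ν y′` (decaying `K`, bounded `X`; pointwise, unconditional otherwise).
* §2 the four WEIGHTED coarse-leg charges of `G̃_j` against the period-`P` face weight: **`hasSum_row_face_inl ∕ _inr`**, **`hasSum_col_face_inl ∕ _inr`**, **`hasSum_colH_face`**,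
  **`tsum_colH_face`** — value `∓K_j·[fine index on the exit face of period Lc·P]·[direction lock]`, `0` on multiplier legs.
* §3 **`inner_faceRead_linT2`** — for any `LocStencil₂` table `T`, POINTWISE in the cell bond: the weighted triple coarse sum of `linT2 G̃_j Lc T μ y ν ·` is
  `−K_j³·Σ_κ Σ'_u colH G̃_j Lc μ y κ u · Ψ_T(κ,u)`, `Ψ_T` the period-`Lc·P` face-masked reduced one-form of `T`.
* §4 **`faceRead_linT2`** — the cell bond summed over `box P` against its face weight (joint-periodicity swap onto `T`'s first slot, then the `ℋ`-column charge):
  `= −K_j⁴·FF_{Lc·P}(T)(μ,ν;α,β)` (nested-mask form).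
* §5 **`faceRead_lin4_coDress`** — THE TRANSPORT ROW (module docstring), conjunctive-mask form on both sides, lower reads on `X` and `Xᵀ`.
Asserts NO value and NO shape of Bałaban's tables; discharges NOTHING of (C)_{≥1} ∕ `hstep` ∕ `hSrc` ∕ `hSrcX` (kinematics of the transport only); NEVER «G-an2-4 closed» as (CONV-C);
NOT D1, NOT `BetaPertH`, NOT continuum, NOT Clay.  2026-08-24; no existing file touched.
-/

noncomputable section

open Finset
open scoped BigOperators
open Literature.MathematicalPhysics.QuantumFieldTheory
open Literature.MathematicalPhysics.QuantumFieldTheory.Balaban1983to89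
open Literature.MathematicalPhysics.QuantumFieldTheory.Balaban1983to89.Beta
open B12Sec2to5 (l1 l1_nonneg)
open ExpKernelCalculus (Site MKer Decays comp shiftK)
open OneStepResolventKernel (Fib)
open OneStepKernelFamily (KInvStep colH abs_colH_le)
open BalabanCompositeJets (LocStencil₂)
open SecondOrderResponse (vertex2OfK)
open BalabanStepJetsSucc (mmRead)
open AffineAveraging (box toSite)
open AveragingContours (blk)
open Summit.QuantumFields.BalabanUV.Beta.AxialDressingRooted (coDressKBmAt decays_coDressKBmAt_KInvStep shiftK_coDressKBmAt_KInvStep)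
open Summit.QuantumFields.BalabanUV.Beta.BorderedHessian (stepScale)
open Summit.QuantumFields.BalabanUV.Beta.HessKerDressedUnits (unitK unitK_apply legScale_inl legScale_inr colH_unitK decays_unitK)
open Summit.QuantumFields.BalabanUV.Beta.KernelWardSwap (vertex2OfK_swap_eq_transpose)
open Summit.QuantumFields.BalabanUV.Beta.GAN24.BiStencilZeroMode (Tab)
open Summit.QuantumFields.BalabanUV.Beta.GAN24.ThirdJetKernel (mmRead_smul)
open Summit.QuantumFields.BalabanUV.Beta.GAN24.T2RecursionAffine (vsym lin4 lin4_apply)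
open Summit.QuantumFields.BalabanUV.Beta.GAN24.Lin4Additive (vertex2OfK_add)
open Summit.QuantumFields.BalabanUV.Beta.GAN24.Lin4ZeroMode (bdd_of_locStencil₂)
open Summit.QuantumFields.BalabanUV.Beta.GAN24.LinT2ZeroMode (linT2 abs_le_of_locStencil₂)
open Summit.QuantumFields.BalabanUV.Beta.GAN24.LinT2ZeroModeStep (shiftK_unitK)
open Summit.QuantumFields.BalabanUV.Beta.GAN24.ZeroModeSandwich (summable_leg_mul_table)
open Summit.QuantumFields.BalabanUV.Beta.GAN24.Push4Iter (locStencil₂_swapT)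
open Summit.QuantumFields.BalabanUV.Beta.GAN24.TableDressingZeroMode (summable_ite_of_summable ite_tsum summable_triple summable_legs summable_faceSum face_shift
  faceSum_periodic)
open Summit.QuantumFields.BalabanUV.Beta.GAN24.FaceWeightedSandwich (colH_block_shift emod_mul_eq_iff)
open Summit.QuantumFields.BalabanUV.Beta.GAN24.CoarseGaugeSourceResponse (summable_bdd_mul summable_source_colH tsum_coord_colH)
open Summit.QuantumFields.BalabanUV.Beta.GAN24.ChargeTowerLegs (hasSum_row_coord_inl hasSum_row_coord_inr hasSum_col_coord_inl hasSum_col_coord_inr)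

namespace Summit.QuantumFields.BalabanUV.Beta.GAN24.FaceReadTransportCharges

variable {d : ℕ}

/-! ## §1 The linear part is half the transport of the slot-symmetrised table -/

/-- [folklore] **`lin4 c K N X μ y ν y′ = (−c∕2) • linT2 K N (X + Xᵀ) μ y ν y′`** for a decaying `K` and a bounded table `X` (`Xᵀ κ u κ′ u′ = X κ′ u′ κ u`): the symmetrised
bi-vertex `vsym = ½(V_X(μy;νy′) + V_X(νy′;μy))` with the swapped term rewritten as the direct bi-vertex of the slot-transposed table (an2's
`KernelWardSwap.vertex2OfK_swap_eq_transpose`) and the two added inside the bi-vertex (leaf-04's `Lin4Additive.vertex2OfK_add`). -/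
theorem lin4_eq_half_linT2_symm {K : MKer (d + 1) (Fib d)} {C δ : ℝ} (hK : Decays K C δ) (hδ : 0 < δ) (c : ℝ) (N : ℕ) [NeZero N]
    {X : Tab d} {B : ℝ} (hX : ∀ κ u κ' u' x z a b, |X κ u κ' u' x z a b| ≤ B)
    (μ : Fin (d + 1)) (y : Fin (d + 1) → ℤ) (ν : Fin (d + 1)) (y' : Fin (d + 1) → ℤ) :
    lin4 c K N X μ y ν y' = (-(c * (1 / 2 : ℝ))) • linT2 K N (X + fun κ u κ' u' => X κ' u' κ u) μ y ν y' := by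
  have hC : 0 ≤ C := hK.nonneg (Sum.inl 0)
  have hXT : ∀ κ u κ' u' x z a b, |(fun κ u κ' u' => X κ' u' κ u) κ u κ' u' x z a b| ≤ B := fun κ u κ' u' x z a b => hX κ' u' κ u x z a b
  rw [lin4_apply]
  simp only [vsym, linT2]
  rw [vertex2OfK_swap_eq_transpose (N := N) ⟨δ, C, hδ, hC, hK⟩ hX μ y ν y', ← vertex2OfK_add hK hδ N hX hXT μ y ν y',
    KernelReflection.comp_smul_right, KernelReflection.comp_smul_left, mmRead_smul, smul_smul, neg_smul, ← neg_smul]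

/-! ## §2 The four weighted coarse-leg charges of the co-dressed, unit-scaled step resolvent against a face weight -/

section Charges

variable {Lc : ℕ} [NeZero Lc] {r : Fin (d + 1) → ℕ}

/-- [folklore] The period-`P` exit-face indicator on `ℤ` is bounded by `1`. -/
theorem abs_faceInd_le (P : ℕ) (s : ℤ) : |(if s % (P : ℤ) = (P : ℤ) - 1 then (1 : ℝ) else 0)| ≤ 1 := by
  split_ifs <;> simp

omit [NeZero Lc] in
/-- [folklore] **TWO SCALES**: the period-`Lc` exit face read with the period-`P` face weight at the block index is the period-`Lc·P` exit face
(`FaceWeightedSandwich.emod_mul_eq_iff`; `blk Lc x a = x_a ∕ Lc`). -/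
theorem faceLc_mul_faceP_blk (hLc : 1 ≤ Lc) {P : ℕ} (hP : 1 ≤ P) (x : Site (d + 1)) (a : Fin (d + 1)) (t : ℝ) :
    (if x a % (Lc : ℤ) = (Lc : ℤ) - 1 then (if blk Lc x a % (P : ℤ) = (P : ℤ) - 1 then t else 0) else 0)
      = if x a % ((Lc * P : ℕ) : ℤ) = ((Lc * P : ℕ) : ℤ) - 1 then t else 0 := by
  have hL : (0 : ℤ) < (Lc : ℤ) := by exact_mod_cast hLc
  have hP' : (0 : ℤ) < (P : ℤ) := by exact_mod_cast hP
  have key := emod_mul_eq_iff hL hP' (x a)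
  have hc : ((Lc * P : ℕ) : ℤ) = (Lc : ℤ) * (P : ℤ) := by push_cast; ring
  rw [hc]
  simp only [blk]
  by_cases h : x a % ((Lc : ℤ) * (P : ℤ)) = (Lc : ℤ) * (P : ℤ) - 1
  · obtain ⟨h1, h2⟩ := key.mp h
    rw [if_pos h1, if_pos h2, if_pos h]
  · rw [if_neg h]
    by_cases h1 : x a % (Lc : ℤ) = (Lc : ℤ) - 1
    · rw [if_pos h1, if_neg (fun h2 => h (key.mpr ⟨h1, h2⟩))]
    · rw [if_neg h1]

/-- NOT IN PRINT; OUR BOOKKEEPING.  **ROW CHARGE, FIELD LEG, FACE WEIGHT**: `Σ'_{x′} [x′_α face_P]·G̃_j (Lc•x′) x (inr α)(inl κ) = −[κ = α]·s_f s_m cH_j·[x_α face_{Lc·P}]`. -/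
theorem hasSum_row_face_inl (hLc : 1 ≤ Lc) (hr : r ∈ box (d + 1) Lc) (sf sm : ℝ) (j : ℕ) {P : ℕ} (hP : 1 ≤ P) (α : Fin (d + 1))
    (x : Site (d + 1)) (κ : Fin (d + 1)) :
    HasSum (fun x' : Site (d + 1) => (if x' α % (P : ℤ) = (P : ℤ) - 1 then (1 : ℝ) else 0) *
        unitK sf sm (coDressKBmAt (toSite r) Lc (KInvStep (d := d) Lc j)) ((Lc : ℤ) • x') x (Sum.inr α) (Sum.inl κ))
      (if κ = α then -(sf * sm * (stepScale d Lc j * (Lc : ℝ) ^ (d + 1))⁻¹) *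
        (if x α % ((Lc * P : ℕ) : ℤ) = ((Lc * P : ℕ) : ℤ) - 1 then (1 : ℝ) else 0) else 0) := by
  have h := (hasSum_row_coord_inl hr j α (fun s : ℤ => if s % (P : ℤ) = (P : ℤ) - 1 then (1 : ℝ) else 0) (abs_faceInd_le P) x κ).mul_left (sm * sf)
  have e : (sm * sf) * -((stepScale d Lc j * (Lc : ℝ) ^ (d + 1))⁻¹ *
        (if κ = α ∧ x α % (Lc : ℤ) = (Lc : ℤ) - 1 then (if blk Lc x α % (P : ℤ) = (P : ℤ) - 1 then (1 : ℝ) else 0) else 0))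
      = (if κ = α then -(sf * sm * (stepScale d Lc j * (Lc : ℝ) ^ (d + 1))⁻¹) *
          (if x α % ((Lc * P : ℕ) : ℤ) = ((Lc * P : ℕ) : ℤ) - 1 then (1 : ℝ) else 0) else 0) := by
    by_cases hκ : κ = α
    · simp only [hκ, true_and, if_true]
      rw [faceLc_mul_faceP_blk hLc hP x α]
      ring
    · simp only [hκ, false_and, if_false, mul_zero, neg_zero]
  rw [e] at h
  refine h.congr_fun fun x' => ?_
  simp only [unitK_apply, legScale_inl, legScale_inr]
  ring

/-- NOT IN PRINT; OUR BOOKKEEPING.  **ROW CHARGE, MULTIPLIER LEG, FACE WEIGHT**: `Σ'_{x′} [x′_α face_P]·G̃_j (Lc•x′) x (inr α)(inr m) = 0`. -/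
theorem hasSum_row_face_inr (hr : r ∈ box (d + 1) Lc) (sf sm : ℝ) (j : ℕ) (P : ℕ) (α : Fin (d + 1)) (x : Site (d + 1)) (m : Fin (d + 1)) :
    HasSum (fun x' : Site (d + 1) => (if x' α % (P : ℤ) = (P : ℤ) - 1 then (1 : ℝ) else 0) *
        unitK sf sm (coDressKBmAt (toSite r) Lc (KInvStep (d := d) Lc j)) ((Lc : ℤ) • x') x (Sum.inr α) (Sum.inr m)) 0 := by
  have h := (hasSum_row_coord_inr hr j α (fun s : ℤ => if s % (P : ℤ) = (P : ℤ) - 1 then (1 : ℝ) else 0) (abs_faceInd_le P) x m).mul_left (sm * sm)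
  rw [mul_zero] at h
  refine h.congr_fun fun x' => ?_
  simp only [unitK_apply, legScale_inr]
  ring

/-- NOT IN PRINT; OUR BOOKKEEPING.  **COLUMN CHARGE, FIELD LEG, FACE WEIGHT**: `Σ'_{z′} [z′_β face_P]·G̃_j w (Lc•z′) (inl κ)(inr β) = [κ = β]·s_f s_m cH_j·[w_β face_{Lc·P}]`. -/
theorem hasSum_col_face_inl (hLc : 1 ≤ Lc) (hr : r ∈ box (d + 1) Lc) (sf sm : ℝ) (j : ℕ) {P : ℕ} (hP : 1 ≤ P) (β : Fin (d + 1))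
    (w : Site (d + 1)) (κ : Fin (d + 1)) :
    HasSum (fun z' : Site (d + 1) => (if z' β % (P : ℤ) = (P : ℤ) - 1 then (1 : ℝ) else 0) *
        unitK sf sm (coDressKBmAt (toSite r) Lc (KInvStep (d := d) Lc j)) w ((Lc : ℤ) • z') (Sum.inl κ) (Sum.inr β))
      (if κ = β then (sf * sm * (stepScale d Lc j * (Lc : ℝ) ^ (d + 1))⁻¹) *
        (if w β % ((Lc * P : ℕ) : ℤ) = ((Lc * P : ℕ) : ℤ) - 1 then (1 : ℝ) else 0) else 0) := by
  have h := (hasSum_col_coord_inl hr j β (fun s : ℤ => if s % (P : ℤ) = (P : ℤ) - 1 then (1 : ℝ) else 0) (abs_faceInd_le P) w κ).mul_left (sf * sm)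
  have e : (sf * sm) * ((stepScale d Lc j * (Lc : ℝ) ^ (d + 1))⁻¹ *
        (if κ = β ∧ w β % (Lc : ℤ) = (Lc : ℤ) - 1 then (if blk Lc w β % (P : ℤ) = (P : ℤ) - 1 then (1 : ℝ) else 0) else 0))
      = (if κ = β then (sf * sm * (stepScale d Lc j * (Lc : ℝ) ^ (d + 1))⁻¹) *
          (if w β % ((Lc * P : ℕ) : ℤ) = ((Lc * P : ℕ) : ℤ) - 1 then (1 : ℝ) else 0) else 0) := by
    by_cases hκ : κ = β
    · simp only [hκ, true_and, if_true]
      rw [faceLc_mul_faceP_blk hLc hP w β]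
      ring
    · simp only [hκ, false_and, if_false, mul_zero]
  rw [e] at h
  refine h.congr_fun fun z' => ?_
  simp only [unitK_apply, legScale_inl, legScale_inr]
  ring

/-- NOT IN PRINT; OUR BOOKKEEPING.  **COLUMN CHARGE, MULTIPLIER LEG, FACE WEIGHT**: `Σ'_{z′} [z′_β face_P]·G̃_j w (Lc•z′) (inr m)(inr β) = 0`. -/
theorem hasSum_col_face_inr (hr : r ∈ box (d + 1) Lc) (sf sm : ℝ) (j : ℕ) (P : ℕ) (β : Fin (d + 1)) (w : Site (d + 1)) (m : Fin (d + 1)) :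
    HasSum (fun z' : Site (d + 1) => (if z' β % (P : ℤ) = (P : ℤ) - 1 then (1 : ℝ) else 0) *
        unitK sf sm (coDressKBmAt (toSite r) Lc (KInvStep (d := d) Lc j)) w ((Lc : ℤ) • z') (Sum.inr m) (Sum.inr β)) 0 := by
  have h := (hasSum_col_coord_inr hr j β (fun s : ℤ => if s % (P : ℤ) = (P : ℤ) - 1 then (1 : ℝ) else 0) (abs_faceInd_le P) w m).mul_left (sm * sm)
  rw [mul_zero] at h
  refine h.congr_fun fun z' => ?_
  simp only [unitK_apply, legScale_inr]
  ring

/-- NOT IN PRINT; OUR BOOKKEEPING.  **`ℋ`-COLUMN CHARGE, FACE WEIGHT** (the two bond slots): `Σ'_y [y_a face_P]·colH G̃_j Lc a y κ u = [κ = a]·s_f s_m cH_j·[u_a face_{Lc·P}]`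
(`colH_unitK` ⨾ road-P2 g41's `tsum_coord_colH`). -/
theorem tsum_colH_face (hLc : 1 ≤ Lc) (hr : r ∈ box (d + 1) Lc) (sf sm : ℝ) (j : ℕ) {P : ℕ} (hP : 1 ≤ P) (a : Fin (d + 1))
    (κ : Fin (d + 1)) (u : Site (d + 1)) :
    ∑' y : Site (d + 1), (if y a % (P : ℤ) = (P : ℤ) - 1 then (1 : ℝ) else 0) *
        colH (unitK sf sm (coDressKBmAt (toSite r) Lc (KInvStep (d := d) Lc j))) Lc a y κ u
      = (if κ = a then (sf * sm * (stepScale d Lc j * (Lc : ℝ) ^ (d + 1))⁻¹) *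
        (if u a % ((Lc * P : ℕ) : ℤ) = ((Lc * P : ℕ) : ℤ) - 1 then (1 : ℝ) else 0) else 0) := by
  have e : ∀ y : Site (d + 1), (if y a % (P : ℤ) = (P : ℤ) - 1 then (1 : ℝ) else 0) *
        colH (unitK sf sm (coDressKBmAt (toSite r) Lc (KInvStep (d := d) Lc j))) Lc a y κ u
      = (sf * sm) * ((if y a % (P : ℤ) = (P : ℤ) - 1 then (1 : ℝ) else 0) * colH (coDressKBmAt (toSite r) Lc (KInvStep (d := d) Lc j)) Lc a y κ u) := by
    intro y
    rw [colH_unitK]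
    simp only [Pi.smul_apply, smul_eq_mul]
    ring
  simp_rw [e]
  rw [tsum_mul_left, tsum_coord_colH hr j a (fun s : ℤ => if s % (P : ℤ) = (P : ℤ) - 1 then (1 : ℝ) else 0) (abs_faceInd_le P) κ u]
  by_cases hκ : κ = a
  · simp only [hκ, true_and, if_true]
    rw [faceLc_mul_faceP_blk hLc hP u a]
    ring
  · simp only [hκ, false_and, if_false, mul_zero]

/-- NOT IN PRINT; OUR BOOKKEEPING.  The same as a `HasSum` (summability from road-P2 g41's `summable_source_colH`). -/
theorem hasSum_colH_face (hLc : 1 ≤ Lc) (hr : r ∈ box (d + 1) Lc) (sf sm : ℝ) (j : ℕ) {P : ℕ} (hP : 1 ≤ P) (a : Fin (d + 1))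
    (κ : Fin (d + 1)) (u : Site (d + 1)) :
    HasSum (fun y : Site (d + 1) => (if y a % (P : ℤ) = (P : ℤ) - 1 then (1 : ℝ) else 0) *
        colH (unitK sf sm (coDressKBmAt (toSite r) Lc (KInvStep (d := d) Lc j))) Lc a y κ u)
      (if κ = a then (sf * sm * (stepScale d Lc j * (Lc : ℝ) ^ (d + 1))⁻¹) *
        (if u a % ((Lc * P : ℕ) : ℤ) = ((Lc * P : ℕ) : ℤ) - 1 then (1 : ℝ) else 0) else 0) := by
  have hs : Summable fun y : Site (d + 1) => (if y a % (P : ℤ) = (P : ℤ) - 1 then (1 : ℝ) else 0) *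
      colH (unitK sf sm (coDressKBmAt (toSite r) Lc (KInvStep (d := d) Lc j))) Lc a y κ u := by
    have h0 := (summable_source_colH (Lc := Lc) r j a κ u).mul_left (sf * sm)
    have h1 : Summable fun y : Site (d + 1) => colH (unitK sf sm (coDressKBmAt (toSite r) Lc (KInvStep (d := d) Lc j))) Lc a y κ u := by
      refine h0.congr fun y => ?_
      rw [colH_unitK]; simp only [Pi.smul_apply, smul_eq_mul]
    exact summable_bdd_mul h1 (fun y => abs_faceInd_le P (y a))
  rw [← tsum_colH_face hLc hr sf sm j hP a κ u]
  exact hs.hasSum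

end Charges

/-! ## §2b Small tools for the sequel: rate change, mask algebra, additivity of the nested face series -/

section Tools

variable {Lc : ℕ}

/-- [folklore] `LocStencil₂` at rate `δ` implies `LocStencil₂` at rate `δ∕3` (same constant). -/
theorem locStencil₂_third {T : Tab d} {C δ : ℝ} (hT : LocStencil₂ T C δ) (hδ : 0 ≤ δ) : LocStencil₂ T C (δ / 3) := by
  have hC : 0 ≤ C := hT.nonneg
  intro κ u κ' u' x z a b
  refine (hT κ u κ' u' x z a b).trans ?_
  have e1 : Real.exp (-δ * l1 (u' - u)) ≤ Real.exp (-(δ / 3) * l1 (u' - u)) :=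
    Real.exp_le_exp.mpr (by nlinarith [l1_nonneg (u' - u)])
  have e2 : Real.exp (-δ * (l1 (x - u) + l1 (z - u))) ≤ Real.exp (-(δ / 3) * (l1 (x - u) + l1 (z - u))) :=
    Real.exp_le_exp.mpr (by nlinarith [l1_nonneg (x - u), l1_nonneg (z - u)])
  exact mul_le_mul (mul_le_mul_of_nonneg_left e1 hC) e2 (Real.exp_pos _).le (mul_nonneg hC (Real.exp_pos _).le)

/-- [folklore] A four-fold conjunctive mask as a product of indicator weights. -/
theorem ite_and₄_eq_mul (A B C D : Prop) [Decidable A] [Decidable B] [Decidable C] [Decidable D] (v : ℝ) :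
    (if A ∧ B ∧ C ∧ D then v else 0)
      = (if A then (1 : ℝ) else 0) * ((if B then (1 : ℝ) else 0) * (if C then (1 : ℝ) else 0) * (if D then (1 : ℝ) else 0) * v) := by
  by_cases hA : A <;> by_cases hB : B <;> by_cases hC : C <;> by_cases hD : D <;> simp [hA, hB, hC, hD]

/-- [folklore] A four-fold conjunctive mask as three nested masks (the last two conditions kept together). -/
theorem ite_and₄_eq_nested (A B E : Prop) [Decidable A] [Decidable B] [Decidable E] (v : ℝ) :
    (if A ∧ B ∧ E then v else 0) = (if A then (if B then (if E then v else 0) else 0) else 0) := by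
  by_cases hA : A <;> by_cases hB : B <;> simp [hA, hB]

/-- [folklore] The nested face-masked triple series of a slice splits additively (summability from `LocStencil₂` of both tables). -/
theorem nestedFace_add {M : ℤ} {Y Y' : Tab d} {C C' δ δ' : ℝ} (hY : LocStencil₂ Y C δ) (hδ : 0 < δ) (hY' : LocStencil₂ Y' C' δ') (hδ' : 0 < δ')
    (μ : Fin (d + 1)) (b : Site (d + 1)) (ν α β : Fin (d + 1)) :
    (∑' u' : Site (d + 1), (if u' ν % M = M - 1 then
        ∑' x : Site (d + 1), ∑' z : Site (d + 1), (if x α % M = M - 1 ∧ z β % M = M - 1 then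
          (Y μ b ν u' x z (Sum.inl α) (Sum.inl β) + Y' μ b ν u' x z (Sum.inl α) (Sum.inl β)) else 0) else 0))
      = (∑' u' : Site (d + 1), (if u' ν % M = M - 1 then
          ∑' x : Site (d + 1), ∑' z : Site (d + 1), (if x α % M = M - 1 ∧ z β % M = M - 1 then Y μ b ν u' x z (Sum.inl α) (Sum.inl β) else 0) else 0))
        + (∑' u' : Site (d + 1), (if u' ν % M = M - 1 then
          ∑' x : Site (d + 1), ∑' z : Site (d + 1), (if x α % M = M - 1 ∧ z β % M = M - 1 then Y' μ b ν u' x z (Sum.inl α) (Sum.inl β) else 0) else 0)) := by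
  classical
  -- summability of the masked leg series and of the masked slot series, for both tables
  have sXZ : ∀ (Z : Tab d) (CZ δZ : ℝ), LocStencil₂ Z CZ δZ → 0 < δZ → ∀ u' : Site (d + 1),
      Summable fun xz : Site (d + 1) × Site (d + 1) =>
        (if xz.1 α % M = M - 1 ∧ xz.2 β % M = M - 1 then Z μ b ν u' xz.1 xz.2 (Sum.inl α) (Sum.inl β) else 0) :=
    fun Z CZ δZ hZ hδZ u' => summable_ite_of_summable (summable_legs hZ hδZ μ b ν u' (Sum.inl α) (Sum.inl β)) _
  have sU : ∀ (Z : Tab d) (CZ δZ : ℝ), LocStencil₂ Z CZ δZ → 0 < δZ →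
      Summable fun u' : Site (d + 1) => (if u' ν % M = M - 1 then
        ∑' x : Site (d + 1), ∑' z : Site (d + 1), (if x α % M = M - 1 ∧ z β % M = M - 1 then Z μ b ν u' x z (Sum.inl α) (Sum.inl β) else 0) else 0) :=
    fun Z CZ δZ hZ hδZ => summable_ite_of_summable
      (summable_faceSum hZ hδZ μ b ν (Sum.inl α) (Sum.inl β) (fun x z => x α % M = M - 1 ∧ z β % M = M - 1)) _
  rw [← Summable.tsum_add (sU Y C δ hY hδ) (sU Y' C' δ' hY' hδ')]
  refine tsum_congr fun u' => ?_
  by_cases hu : u' ν % M = M - 1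
  · simp only [if_pos hu]
    have hx := (sXZ Y C δ hY hδ u').prod
    have hx' := (sXZ Y' C' δ' hY' hδ' u').prod
    rw [← Summable.tsum_add hx hx']
    refine tsum_congr fun x => ?_
    rw [← Summable.tsum_add ((sXZ Y C δ hY hδ u').prod_factor x) ((sXZ Y' C' δ' hY' hδ' u').prod_factor x)]
    refine tsum_congr fun z => ?_
    split_ifs
    · rfl
    · rw [add_zero]
  · simp only [if_neg hu, add_zero]

end Tools

end Summit.QuantumFields.BalabanUV.Beta.GAN24.FaceReadTransportCharges

end
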